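import Mathlib
import Summits.ResolutionOfSingularities.ResolutionOfSingularities.Theorems.HomologicalConductorPersistenceKC3LocalModelCa
import Summits.ResolutionOfSingularities.ResolutionOfSingularities.Theorems.HomologicalConductorPersistenceKC3NormalLoc
import Summits.ResolutionOfSingularities.ResolutionOfSingularities.Theorems.HomologicalConductorPersistenceMonomialValuationKC3
import HarnessLib

/-!
# Crux `Persistence` (stmt-ResolutionOfSingularities-16484) — w44b K-C3, K5: THE GLUE
# `Persistence ∧ (K2-lower at T₀) ⇒ x ∈ ca T₁` at the K-C3 datum of record, everything else discharged

Route `ResolutionOfSingularities/HomologicalConductor`, chain W4.4b (cell `res-hironaka`), crux `Persistence`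
(stmt-ResolutionOfSingularities-16484), KILL CANDIDATE K-C3 (CHAIN w44b v13.4 §V13.12), KC3 SPELLING v1.1; res-L1-w44b-plan-1
12:00:59Z / 13:03:18Z (6) «res-type-010: K5 skeleton with binders exactly = {the sockets}». OURS; nothing here is a statement of
the manuscript under review (Hironaka 2017); AI-written, weaker than expert review. Filed `--supports stmt-ResolutionOfSingularities-16484
--as helper` (kind proof). **This file does NOT conclude `¬ Persistence` and types no negation of the crux: it derives `x ∈ ca T₁`
from `Persistence` + socket S1; socket S2 (`x ∉ ca T₁`) is the other owners' theorem**
(ROUTE-HYGIENE HOLD, CHAIN §V13.11.3: no `--kind refutation`, no `close --as refuted`; the modus ponens is the planner's / priority8's).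

THE DATUM (KC3 SPELLING v1.1): `k` any field of characteristic `p` (the crux's `[CharP k p]`), `K = Frac k[x,z,t]`
(`FractionRing (MvPolynomial (Fin 3) k)`), `x, z, t` the coordinate functions, `y = (z³+t⁴)·x⁻¹`, `A = k[x, z, t, y]`,
`W = k[x, z, t, z²/x, zt/x, t²/x, z³/x²]`, `O = O_w` the monomial valuation ring of weights `(6, 5, 4)` (res-type-084's
`monomialValuationRing k (kc3Weight 1) K`), `T₀ = loc O A`, `T₁ = loc O W`, `ca` the route's set-valued cohomology annihilator.

THE TWO SOCKETS (hypotheses, to be supplied by their owners' files):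
* `S1` (K2-LOWER at `T₀`, res-type-011 K2c (c2)(c3) composed with `exists_kc3LocModelEquiv`):
  `{α x + β y + γ z² + δ zt + ε t² | α, …, ε ∈ T₀} ⊆ ca T₀`;
* `S2` (K4 at `T₁`, res-D-pv-058 K4c `not_stablyAnnihilates_xLoc` + res-D-pv-037 Frobenius-order device + res-D-pv-021 σ): `x ∉ ca T₁`.
DISCHARGED HERE from the tree: `k ⊆ O`, `A ≤ O`, `W ⊆ O` (084), `A.FG`, `Frac A = K`, the values `v(x), v(y), v(z), v(t) < 1`,
`ca T₀ ⊆ I·T₀` (p534738 `kc3_ca_loc_subset`) hence `ca T₀ = I·T₀` with `S1`, `x ∈ ca T₀` (p534738 `kc3_x_mem_ca_loc`),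
`T₁ = tower O A 1 = loc O W` (043 p528915 + 021 p532533 `kc3_tower_one_eq_of_ca`), and the instance `m = 0` of the crux.

* `kc3_valuation_lt_one` — `v(x), v(y), v(z), v(t) < 1` in `O_w`; `kc3_A_fg`; `kc3_isFractionRing_A`;
* adapters `not_mem_ca_of_forall_not_mem` (ring-level `∉ cohomologyAnnihilator ↥B` ⇒ set-level `∉ ca B`) and
  `kc3_lower_subset_of_span_le` (ideal-level lower bound in `↥T₀` ⇒ `S1`);
* **`kc3_x_mem_ca_loc_W_of_persistence (p) (hp) [CharP k p] (hP : Persistence) (S1) : x ∈ ca (loc O W)`** (positive form;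
  with `S2` it is the contradiction) and its ring-level-socket variant `…'`.
-/

noncomputable section

-- single-problem summit: the doubled namespace component `ResolutionOfSingularities` is forced
set_option linter.dupNamespace false

namespace Summit.ResolutionOfSingularities.ResolutionOfSingularities.Theorems.HomologicalConductor.KC3Glue

open MvPolynomial WithZero
open Literature.RingTheory.CohomologyAnnihilator
open Summit.ResolutionOfSingularities.ResolutionOfSingularities.Theses.HomologicalConductor
open Summit.ResolutionOfSingularities.ResolutionOfSingularities.Theorems.NoZeno.Birth
open Summit.ResolutionOfSingularities.ResolutionOfSingularities.Theorems.HomologicalConductor.PersistenceMonomialValuation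
open Summit.ResolutionOfSingularities.ResolutionOfSingularities.Theorems.HomologicalConductor.PersistenceKC3NormalLoc
open Summit.ResolutionOfSingularities.ResolutionOfSingularities.Theorems.HomologicalConductor.KC3Upper

variable {k : Type} [Field k]

local notation3 "𝕂" => FractionRing (MvPolynomial (Fin 3) k)
local notation3 "ι" => algebraMap (MvPolynomial (Fin 3) k) (FractionRing (MvPolynomial (Fin 3) k))
local notation3 "𝔵" => algebraMap (MvPolynomial (Fin 3) k) (FractionRing (MvPolynomial (Fin 3) k)) (MvPolynomial.X 0)
local notation3 "𝔷" => algebraMap (MvPolynomial (Fin 3) k) (FractionRing (MvPolynomial (Fin 3) k)) (MvPolynomial.X 1)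
local notation3 "𝔱" => algebraMap (MvPolynomial (Fin 3) k) (FractionRing (MvPolynomial (Fin 3) k)) (MvPolynomial.X 2)
/-- `O = O_w`, the monomial valuation ring of weights `(6,5,4) = kc3Weight 1` (res-type-084; local notation only). -/
local notation3 "𝕆" => monomialValuationRing k (kc3Weight 1) (FractionRing (MvPolynomial (Fin 3) k))
/-- `W = k[x, z, t, z²x⁻¹, ztx⁻¹, t²x⁻¹, z³x⁻¹x⁻¹]` (spelled as in `kc3_tower_one_eq`; local notation only). -/
local notation3 "𝕎" => Algebra.adjoin k
  ({algebraMap (MvPolynomial (Fin 3) k) (FractionRing (MvPolynomial (Fin 3) k)) (MvPolynomial.X 0),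
    algebraMap (MvPolynomial (Fin 3) k) (FractionRing (MvPolynomial (Fin 3) k)) (MvPolynomial.X 1),
    algebraMap (MvPolynomial (Fin 3) k) (FractionRing (MvPolynomial (Fin 3) k)) (MvPolynomial.X 2),
    algebraMap (MvPolynomial (Fin 3) k) (FractionRing (MvPolynomial (Fin 3) k)) (MvPolynomial.X 1) ^ 2 *
      (algebraMap (MvPolynomial (Fin 3) k) (FractionRing (MvPolynomial (Fin 3) k)) (MvPolynomial.X 0))⁻¹,
    algebraMap (MvPolynomial (Fin 3) k) (FractionRing (MvPolynomial (Fin 3) k)) (MvPolynomial.X 1) *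
      algebraMap (MvPolynomial (Fin 3) k) (FractionRing (MvPolynomial (Fin 3) k)) (MvPolynomial.X 2) *
      (algebraMap (MvPolynomial (Fin 3) k) (FractionRing (MvPolynomial (Fin 3) k)) (MvPolynomial.X 0))⁻¹,
    algebraMap (MvPolynomial (Fin 3) k) (FractionRing (MvPolynomial (Fin 3) k)) (MvPolynomial.X 2) ^ 2 *
      (algebraMap (MvPolynomial (Fin 3) k) (FractionRing (MvPolynomial (Fin 3) k)) (MvPolynomial.X 0))⁻¹,
    algebraMap (MvPolynomial (Fin 3) k) (FractionRing (MvPolynomial (Fin 3) k)) (MvPolynomial.X 1) ^ 3 *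
      (algebraMap (MvPolynomial (Fin 3) k) (FractionRing (MvPolynomial (Fin 3) k)) (MvPolynomial.X 0))⁻¹ *
      (algebraMap (MvPolynomial (Fin 3) k) (FractionRing (MvPolynomial (Fin 3) k)) (MvPolynomial.X 0))⁻¹} :
    Set (FractionRing (MvPolynomial (Fin 3) k)))
/-- `A = k[x, z, t, (z³+t⁴)x⁻¹]` (spelled as in `kc3_tower_one_eq`; local notation only). -/
local notation3 "𝔸" => Algebra.adjoin k
  ({algebraMap (MvPolynomial (Fin 3) k) (FractionRing (MvPolynomial (Fin 3) k)) (MvPolynomial.X 0),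
    algebraMap (MvPolynomial (Fin 3) k) (FractionRing (MvPolynomial (Fin 3) k)) (MvPolynomial.X 1),
    algebraMap (MvPolynomial (Fin 3) k) (FractionRing (MvPolynomial (Fin 3) k)) (MvPolynomial.X 2),
    (algebraMap (MvPolynomial (Fin 3) k) (FractionRing (MvPolynomial (Fin 3) k)) (MvPolynomial.X 1) ^ 3 +
        algebraMap (MvPolynomial (Fin 3) k) (FractionRing (MvPolynomial (Fin 3) k)) (MvPolynomial.X 2) ^ 4) *
      (algebraMap (MvPolynomial (Fin 3) k) (FractionRing (MvPolynomial (Fin 3) k)) (MvPolynomial.X 0))⁻¹} :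
    Set (FractionRing (MvPolynomial (Fin 3) k)))

/-! ## §1 The datum meets the crux's binders -/

/-- From `v_w(y) < 1` (the `ℤᵐ⁰`-valued monomial valuation) to `O.valuation y < 1` (the valuation ring's own valuation). [folklore] -/
theorem valuation_lt_one_of_frac_lt_one {y : 𝕂} (hyO : y ∈ 𝕆)
    (h : monomialValuationFrac k (kc3Weight 1) 𝕂 y < 1) : (𝕆).valuation y < 1 :=
  (ValuationSubring.valuation_lt_one_iff 𝕆 ⟨y, hyO⟩).mp ((mem_maximalIdeal_iff_valuation_lt_one k _ 𝕂 ⟨y, hyO⟩).mpr h)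

/-- **The centre of `O_w` on `A` is the origin**: `v(x), v(y), v(z), v(t) < 1`. [folklore] -/
theorem kc3_valuation_lt_one :
    (𝕆).valuation 𝔵 < 1 ∧ (𝕆).valuation ((𝔷 ^ 3 + 𝔱 ^ 4) * 𝔵⁻¹) < 1 ∧ (𝕆).valuation 𝔷 < 1 ∧ (𝕆).valuation 𝔱 < 1 := by
  refine ⟨valuation_lt_one_of_frac_lt_one (algebraMap_mem k _ 𝕂 _) ?_,
    valuation_lt_one_of_frac_lt_one (kc3_y_mem k 𝕂 1) ?_,
    valuation_lt_one_of_frac_lt_one (algebraMap_mem k _ 𝕂 _) ?_,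
    valuation_lt_one_of_frac_lt_one (algebraMap_mem k _ 𝕂 _) ?_⟩
  · rw [monomialValuationFrac_X, ← exp_zero, exp_lt_exp]; simp [kc3Weight]
  · rw [monomialValuationFrac_kc3_y, ← exp_zero, exp_lt_exp]; omega
  · rw [monomialValuationFrac_X, ← exp_zero, exp_lt_exp]; simp [kc3Weight]
  · rw [monomialValuationFrac_X, ← exp_zero, exp_lt_exp]; simp [kc3Weight]

/-- Polynomials in `x, z, t` lie in `A`. [folklore] -/
theorem algebraMap_mem_A (g : MvPolynomial (Fin 3) k) : ι g ∈ 𝔸 := by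
  induction g using MvPolynomial.induction_on with
  | C a =>
    have : ι (C a) = algebraMap k 𝕂 a := by
      rw [IsScalarTower.algebraMap_apply k (MvPolynomial (Fin 3) k) 𝕂 a, MvPolynomial.algebraMap_eq]
    rw [this]
    exact Subalgebra.algebraMap_mem _ a
  | add p q hp hq => rw [map_add]; exact Subalgebra.add_mem _ hp hq
  | mul_X p i hp =>
    rw [map_mul]
    refine Subalgebra.mul_mem _ hp (Algebra.subset_adjoin ?_)
    fin_cases i <;> simp

/-- **`A` is finitely generated** (four generators). [folklore] -/
theorem kc3_A_fg : (𝔸 : Subalgebra k 𝕂).FG :=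
  Subalgebra.fg_def.mpr ⟨_, Set.toFinite _, rfl⟩

/-- **`Frac A = K`** (`k[x,z,t] ⊆ A ⊆ K = k(x,z,t)`). [folklore] -/
theorem kc3_isFractionRing_A : IsFractionRing ↥(𝔸 : Subalgebra k 𝕂) 𝕂 := by
  apply IsFractionRing.of_field
  intro y
  obtain ⟨a, b, -, rfl⟩ := IsFractionRing.div_surjective (A := MvPolynomial (Fin 3) k) y
  exact ⟨⟨ι a, algebraMap_mem_A a⟩, ⟨ι b, algebraMap_mem_A b⟩, rfl⟩

/-! ## §2 Adapters from the socket owners' ring-level statements to the route's set-valued `ca` -/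

/-- Ring-level non-membership gives set-level non-membership: if `⟨x, hx⟩ ∉ cohomologyAnnihilator ↥B` for every proof `hx`,
then `x ∉ ca B` (`Subalgebra.image_coe_cohomologyAnnihilator`). [folklore] -/
theorem not_mem_ca_of_forall_not_mem {K' : Type} [Field K'] [Algebra k K'] (B : Subalgebra k K') {x : K'}
    (h : ∀ hx : x ∈ B, (⟨x, hx⟩ : ↥B) ∉ cohomologyAnnihilator ↥B) : x ∉ NoZeno.Birth.ca B := by
  intro hx
  have hb := Subalgebra.image_coe_cohomologyAnnihilator B
  have hx' : x ∈ ((↑) : ↥B → K') '' (cohomologyAnnihilator ↥B : Set ↥B) := by rw [hb]; exact hx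
  obtain ⟨u, hu, rfl⟩ := hx'
  exact h u.2 hu

/-- Ideal-level lower bound in `↥T₀` gives the set-level socket `S1`: if the five elements `x, y, z², zt, t²` of `T₀ = loc O A`
lie in `cohomologyAnnihilator ↥T₀`, then every `T₀`-combination of them lies in `ca T₀`. [folklore] -/
theorem kc3_lower_subset_of_mem (O : ValuationSubring 𝕂)
    (hxT : ∀ h, (⟨𝔵, h⟩ : ↥(loc O 𝔸)) ∈ cohomologyAnnihilator ↥(loc O 𝔸))
    (hyT : ∀ h, (⟨(𝔷 ^ 3 + 𝔱 ^ 4) * 𝔵⁻¹, h⟩ : ↥(loc O 𝔸)) ∈ cohomologyAnnihilator ↥(loc O 𝔸))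
    (hzzT : ∀ h, (⟨𝔷 ^ 2, h⟩ : ↥(loc O 𝔸)) ∈ cohomologyAnnihilator ↥(loc O 𝔸))
    (hztT : ∀ h, (⟨𝔷 * 𝔱, h⟩ : ↥(loc O 𝔸)) ∈ cohomologyAnnihilator ↥(loc O 𝔸))
    (httT : ∀ h, (⟨𝔱 ^ 2, h⟩ : ↥(loc O 𝔸)) ∈ cohomologyAnnihilator ↥(loc O 𝔸)) :
    {c : 𝕂 | ∃ α β γ δ ε : 𝕂, α ∈ loc O 𝔸 ∧ β ∈ loc O 𝔸 ∧ γ ∈ loc O 𝔸 ∧ δ ∈ loc O 𝔸 ∧ ε ∈ loc O 𝔸 ∧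
        c = α * 𝔵 + β * ((𝔷 ^ 3 + 𝔱 ^ 4) * 𝔵⁻¹) + γ * 𝔷 ^ 2 + δ * (𝔷 * 𝔱) + ε * 𝔱 ^ 2} ⊆ NoZeno.Birth.ca (loc O 𝔸) := by
  rintro c ⟨α, β, γ, δ, ε, hα, hβ, hγ, hδ, hε, rfl⟩
  have hxA : (𝔵 : 𝕂) ∈ loc O 𝔸 := mem_loc_of_mem O _ (Algebra.subset_adjoin (by simp))
  have hzA : (𝔷 : 𝕂) ∈ loc O 𝔸 := mem_loc_of_mem O _ (Algebra.subset_adjoin (by simp))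
  have htA : (𝔱 : 𝕂) ∈ loc O 𝔸 := mem_loc_of_mem O _ (Algebra.subset_adjoin (by simp))
  have hyA : (𝔷 ^ 3 + 𝔱 ^ 4) * 𝔵⁻¹ ∈ loc O 𝔸 := mem_loc_of_mem O _ (Algebra.subset_adjoin (by simp))
  have hzz : (𝔷 : 𝕂) ^ 2 ∈ loc O 𝔸 := Subalgebra.pow_mem _ hzA 2
  have hzt : (𝔷 : 𝕂) * 𝔱 ∈ loc O 𝔸 := Subalgebra.mul_mem _ hzA htA
  have htt : (𝔱 : 𝕂) ^ 2 ∈ loc O 𝔸 := Subalgebra.pow_mem _ htA 2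
  set T := loc O 𝔸 with hT
  have hu : (⟨α, hα⟩ * ⟨𝔵, hxA⟩ + ⟨β, hβ⟩ * ⟨_, hyA⟩ + ⟨γ, hγ⟩ * ⟨_, hzz⟩ + ⟨δ, hδ⟩ * ⟨_, hzt⟩ + ⟨ε, hε⟩ * ⟨_, htt⟩ : ↥T) ∈
      cohomologyAnnihilator ↥T :=
    Ideal.add_mem _ (Ideal.add_mem _ (Ideal.add_mem _ (Ideal.add_mem _ (Ideal.mul_mem_left _ _ (hxT hxA))
      (Ideal.mul_mem_left _ _ (hyT hyA))) (Ideal.mul_mem_left _ _ (hzzT hzz))) (Ideal.mul_mem_left _ _ (hztT hzt)))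
      (Ideal.mul_mem_left _ _ (httT htt))
  have hb := Subalgebra.image_coe_cohomologyAnnihilator T
  have hmem : α * 𝔵 + β * ((𝔷 ^ 3 + 𝔱 ^ 4) * 𝔵⁻¹) + γ * 𝔷 ^ 2 + δ * (𝔷 * 𝔱) + ε * 𝔱 ^ 2 ∈
      ((↑) : ↥T → 𝕂) '' (cohomologyAnnihilator ↥T : Set ↥T) := ⟨_, hu, rfl⟩
  rw [hb] at hmem
  exact hmem

/-! ## §3 The glue (positive form: `Persistence ∧ S1 ⇒ x ∈ ca T₁`; with `S2 : x ∉ ca T₁` this is the contradiction) -/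

/-- **K5 GLUE (OURS · w44b K-C3).** For ANY prime `p` and ANY field `k` of characteristic `p`, at the K-C3 datum
(`K = k(x,z,t)`, `O = O_(6,5,4)`, `A = k[x,z,t,(z³+t⁴)/x]`, `W` the `x`-chart): IF `Persistence` holds and the K2-LOWER socket
`S1 : (x, y, z², zt, t²)·T₀ ⊆ ca T₀` holds, THEN **`x ∈ ca T₁`, `T₁ = loc O W`** — which the K4 socket `S2 : x ∉ ca T₁`
(res-D-pv-058 `not_stablyAnnihilates_xLoc` + res-D-pv-037's Frobenius-order device) contradicts. Everything else — the crux's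
binders at the datum (084), `ca T₀ ⊆ I·T₀` and `x ∈ ca T₀` (p534738), `tower O A 1 = loc O W` (043 p528915 + 021 p532533) — is
discharged from the tree; the crux is instantiated at `m = 0`. Stated POSITIVELY on purpose (ROUTE-HYGIENE HOLD, CHAIN §V13.11.3):
no negation of the crux is typed here; the modus tollens with `S2` is the planner's / priority8's call. [OURS · L1 w44b] -/
theorem kc3_x_mem_ca_loc_W_of_persistence (p : ℕ) (hp : p.Prime) [CharP k p] (hP : Persistence)
    (S1 : {c : 𝕂 | ∃ α β γ δ ε : 𝕂, α ∈ loc 𝕆 𝔸 ∧ β ∈ loc 𝕆 𝔸 ∧ γ ∈ loc 𝕆 𝔸 ∧ δ ∈ loc 𝕆 𝔸 ∧ ε ∈ loc 𝕆 𝔸 ∧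
        c = α * 𝔵 + β * ((𝔷 ^ 3 + 𝔱 ^ 4) * 𝔵⁻¹) + γ * 𝔷 ^ 2 + δ * (𝔷 * 𝔱) + ε * 𝔱 ^ 2} ⊆ NoZeno.Birth.ca (loc 𝕆 𝔸)) :
    (𝔵 : 𝕂) ∈ NoZeno.Birth.ca (loc 𝕆 𝕎) := by
  have hk : ∀ c : k, algebraMap k 𝕂 c ∈ 𝕆 := kc3_algebraMap_base_mem k 𝕂 1
  have hAO := kc3_adjoin_toSubring_le k 𝕂 1
  have hWO := kc3_W_subset k 𝕂 1
  haveI := kc3_isFractionRing_A (k := k)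
  obtain ⟨hx, hy, hz, ht⟩ := kc3_valuation_lt_one (k := k)
  -- the centre at `T₀` is EXACTLY `I·T₀`: `⊆` fact-free (p534738), `⊇` = socket S1
  have hca : NoZeno.Birth.ca (loc 𝕆 𝔸) =
      {c : 𝕂 | ∃ α β γ δ ε : 𝕂, α ∈ loc 𝕆 𝔸 ∧ β ∈ loc 𝕆 𝔸 ∧ γ ∈ loc 𝕆 𝔸 ∧ δ ∈ loc 𝕆 𝔸 ∧ ε ∈ loc 𝕆 𝔸 ∧
        c = α * 𝔵 + β * ((𝔷 ^ 3 + 𝔱 ^ 4) * 𝔵⁻¹) + γ * 𝔷 ^ 2 + δ * (𝔷 * 𝔱) + ε * 𝔱 ^ 2} :=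
    Set.Subset.antisymm (kc3_ca_loc_subset k 𝕂 𝕆 hk hx hy hz ht) S1
  -- the crux at the datum, `m = 0`
  have h := hP p hp k 𝕂 𝕆 𝔸 hk kc3_A_fg inferInstance hAO
  have h0 : NoZeno.Birth.ca (tower 𝕆 𝔸 0) ⊆ NoZeno.Birth.ca (tower 𝕆 𝔸 1) := h 0
  rw [tower_zero, kc3_tower_one_eq_of_ca 𝕆 hWO hca] at h0
  exact h0 (kc3_x_mem_ca_loc k 𝕂 𝕆 hk hx hy hz ht)

/-- The same with the K2-LOWER socket in RING-LEVEL form (the five memberships in `cohomologyAnnihilator ↥T₀`, the shape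
res-type-011's `span_le_cohomologyAnnihilator_of_isLocalization_xy` delivers once `T₀` is presented as a localisation of
`KC3RingXY` at its origin). [OURS · L1 w44b] -/
theorem kc3_x_mem_ca_loc_W_of_persistence' (p : ℕ) (hp : p.Prime) [CharP k p] (hP : Persistence)
    (hxT : ∀ h, (⟨𝔵, h⟩ : ↥(loc 𝕆 𝔸)) ∈ cohomologyAnnihilator ↥(loc 𝕆 𝔸))
    (hyT : ∀ h, (⟨(𝔷 ^ 3 + 𝔱 ^ 4) * 𝔵⁻¹, h⟩ : ↥(loc 𝕆 𝔸)) ∈ cohomologyAnnihilator ↥(loc 𝕆 𝔸))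
    (hzzT : ∀ h, (⟨𝔷 ^ 2, h⟩ : ↥(loc 𝕆 𝔸)) ∈ cohomologyAnnihilator ↥(loc 𝕆 𝔸))
    (hztT : ∀ h, (⟨𝔷 * 𝔱, h⟩ : ↥(loc 𝕆 𝔸)) ∈ cohomologyAnnihilator ↥(loc 𝕆 𝔸))
    (httT : ∀ h, (⟨𝔱 ^ 2, h⟩ : ↥(loc 𝕆 𝔸)) ∈ cohomologyAnnihilator ↥(loc 𝕆 𝔸)) :
    (𝔵 : 𝕂) ∈ NoZeno.Birth.ca (loc 𝕆 𝕎) :=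
  kc3_x_mem_ca_loc_W_of_persistence p hp hP (kc3_lower_subset_of_mem 𝕆 hxT hyT hzzT hztT httT)

end Summit.ResolutionOfSingularities.ResolutionOfSingularities.Theorems.HomologicalConductor.KC3Glue

end
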